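/-
Origin: expansion seat `prover-pub-hodgecm-own-htheta-0`, handover #H2 2026-08-21T04:3xZ md5 82acc09f928e (130 l.; NEW additive leaf; imports #H1 + HodgeCM.Model.ArchKTypeOfCentralWeightR234 (#CA73) + HodgeCM.Model.LiuDictionaryPinEq (#103); ns HodgeCM.Model.LiuIndex; 6 theorems 0 defs (+ mk_repAt): binder-2's `hμ` of `hJ_slot_k` DISCHARGED at the R2 pin of record for k = 0,1,2,3 at μ := muLiu ι₁ ρ; NAMES for audit: HodgeCM.Model.LiuIndex.muLiu_mk_eq_add_ROGT'C_zero · …_one · …_two · …_three · HodgeCM.Model.LiuIndex.muLiu_mk_slot_eq) (`HOME/pub-hodgecm-own-htheta/stage72/HodgeCM/Model/LiuIndexMuLiuR2.lean`, md5 82acc09f928e, 130 lines);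
landed by the second packager p2 gen 18 (p2-g18) in gate run 72 as `HodgeCM/Model/LiuIndexMuLiuR2.lean` (verbatim).
-/
/-
Copyright (c) 2026 the pub-hodgecm formalisation cell (harness21).  New file, not vendored.
Origin: ROW-9 OWNER seat `prover-pub-hodgecm-own-htheta-0` (unit pub-hodgecm-own-htheta, named single owner of binder row 9 `hΘ`),
2026-08-21.  Target in PKG: `HodgeCM/Model/LiuIndexMuLiuR2.lean` (NEW additive KERNEL leaf beside E; imports this seat's
`HodgeCM.Model.LiuIndexMuLiu` + carch-1 #CA73 `HodgeCM.Model.ArchKTypeOfCentralWeightR234` (RUN 71) + binder-2 #103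
`HodgeCM.Model.LiuDictionaryPinEq` (RUN 70, the pointed section `repAt`); nothing imports it; outside E's import
closure).  KERNEL ONLY: theorems; 0 defs, 0 records, nothing cited, 0 `def … : Prop`.  Nothing here is a claim of the manuscripts under adjudication.
-/
import Summits.HodgeConjecture.HodgeCM.Model.LiuIndexMuLiu
import Summits.HodgeConjecture.HodgeCM.Model.ArchKTypeOfCentralWeightR234_2
import Summits.HodgeConjecture.HodgeCM.Model.LiuDictionaryPinEq

set_option autoImplicit false

/-!
# The junction's `hμ` AT THE PIN OF RECORD R2, all four slots, at the recipe of record `μ₀ := LiuIndex.muLiu`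

For the pin of record R2 (`SInstance.SROGT'C …`, slot characters `etaT_k V c.D (EtaChi.η χVR (χWR μ) V c) (νR ∣ ν'R)`) under the guard `hc : GOG V c` (whose second
component is the sign-recipe context `SignRecipe.GoodCtx (orientBitι L ι₁) ι₁ c`), for every section `ρ` of `GramClass.mk`
(e.g. `GramClass.rep`, binder-2 #103 `LiuIndex.repAt a₀`) and each slot `k = 0, 1, 2, 3`:

  `muLiu ι₁ ρ ⟦a_k⟧ = charArchType (s_k ∘ centre_∞) + centralTypeOf V a_k (hGR_k V c)`

with `s_k := lineCharV_k … (etaT_k V c.D (EtaChi.η χVR (χWR μ) V c) (νR V c ∣ ν'R V c))` the `V`-character of the slot's twisted dictionary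
record (= sinst-1's `adelicChar_k… (etaT_k …)` by `rfl`) and `a_k := ⟨dW c.D k, …⟩` (`k = 0,1`) ∕ `⟨dW' c.D (k−2), …⟩` (`k = 2,3`)
(= `⟨c.D.a k, c.D.a_real k, c.D.a_ne k⟩` by `rfl`, binder-2 `ScalarDefeq`).  This is EXACTLY the hypothesis `hμ` of binder-2's slot theorems
`hJ_slot_k` (`Model/Binders/JLiuSlots`, RUN 72) at `μ := muLiu ι₁ ρ` — so at the recipe of record `hμ` is a THEOREM, not an input: by
`LiuIndex.muLiu_mk_eq_add_of_CC` from carch's (CC_k) `SInstance.lineCharV_k_center_mul_lineC_ROGT'C` (#CA72 ∕ #CA73) and `ι₁ ∈ Φ^δ(a_k)`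
(binder-2 #94 `SignRecipe.GoodCtx.self_mem_lineType`).  The continuity of `s_k` is taken as a hypothesis (sinst-1's `continuous_adelicChar…_val`
at the pin; binder-2's `hc₁`).
-/

noncomputable section

open NumberField NumberField.InfinitePlace NumberField.mixedEmbedding IsDedekindDomain
open scoped Matrix Classical
open Literature.NumberTheory.Automorphic Literature.NumberTheory.Automorphic.UnitaryGroup Literature.NumberTheory.Weil1964
open Literature.NumberTheory.GelbartRogawski1991 Literature.NumberTheory.GelbartRogawski1991.UnitaryDualPair
open HodgeCM.Adelic HodgeCM.PerL34 HodgeCM.Model.HypCensus HodgeCM.Model.SupplyInstance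

namespace HodgeCM.Model.LiuIndex

open HodgeCM.Model.ArchSideTerm HodgeCM.Model.SInstance

variable
  (hGR : ∀ {L : CMField} {ι₁ : L →+* ℂ} (V : HermSpace3 L ι₁) (c : SeesawCtx L),
    (cmSplittingDatum (L : Type) finProdFinEquiv (frameD V) (frameD_real V) (frameD_ne V) (dW c.D) (dW_real c.D)
      (dW_ne c.D)).CompatibleSplitting)
  (hGR₀ : ∀ {L : CMField} {ι₁ : L →+* ℂ} (V : HermSpace3 L ι₁) (c : SeesawCtx L),
    (cmSplittingDatum (L : Type) (e₁) (frameD V) (frameD_real V) (frameD_ne V) (lineVec (L : Type) (dW c.D 0))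
      (fun _ => dW_real c.D 0) (fun _ => dW_ne c.D 0)).CompatibleSplitting)
  (hGR₁ : ∀ {L : CMField} {ι₁ : L →+* ℂ} (V : HermSpace3 L ι₁) (c : SeesawCtx L),
    (cmSplittingDatum (L : Type) (e₁) (frameD V) (frameD_real V) (frameD_ne V) (lineVec (L : Type) (dW c.D 1))
      (fun _ => dW_real c.D 1) (fun _ => dW_ne c.D 1)).CompatibleSplitting)
  (hGR₂ : ∀ {L : CMField} {ι₁ : L →+* ℂ} (V : HermSpace3 L ι₁) (c : SeesawCtx L),
    (cmSplittingDatum (L : Type) (e₁) (frameD V) (frameD_real V) (frameD_ne V) (lineVec (L : Type) (dW' c.D 0))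
      (fun _ => dW'_real c.D 0) (fun _ => dW'_ne c.D 0)).CompatibleSplitting)
  (hGR₃ : ∀ {L : CMField} {ι₁ : L →+* ℂ} (V : HermSpace3 L ι₁) (c : SeesawCtx L),
    (cmSplittingDatum (L : Type) (e₁) (frameD V) (frameD_real V) (frameD_ne V) (lineVec (L : Type) (dW' c.D 1))
      (fun _ => dW'_real c.D 1) (fun _ => dW'_ne c.D 1)).CompatibleSplitting)
  (μ : ∀ {L : CMField}, SeesawCtx L → Fin 4 → NumberField.InfinitePlace (L : Type) → ℤ)

variable {L : CMField} {ι₁ : L →+* ℂ} (V : HermSpace3 L ι₁) (c : SeesawCtx L)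
variable (ρ : GramClass L → RealScalar L)

/-- **slot 0 at the R2 pin**: `muLiu ι₁ ρ ⟦a₀⟧ = charArchType (s₀ ∘ centre_∞) + centralTypeOf V a₀ (hGR₀ V c)`. [folklore] -/
theorem muLiu_mk_eq_add_ROGT'C_zero (hρ : ∀ q, GramClass.mk (ρ q) = q) (hc : GOG V c)
    (hcV : Continuous fun v => ((lineCharV_zero V c.D (hGR V c) (hGR₀ V c) (hGR₁ V c)
      (etaT₀ V c.D (EtaChi.η (@χVR @hGR @hGR₀ @hGR₁) (@χWR @hGR @hGR₀ @hGR₁ @μ) V c) (νR @hGR₁ V c)) v : ℂˣ) : ℂ)) :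
    muLiu ι₁ ρ (GramClass.mk ⟨dW c.D 0, dW_real c.D 0, dW_ne c.D 0⟩) =
      Literature.NumberTheory.Automorphic.charArchType (L : Type)
          (centerCharInf V (lineCharV_zero V c.D (hGR V c) (hGR₀ V c) (hGR₁ V c)
            (etaT₀ V c.D (EtaChi.η (@χVR @hGR @hGR₀ @hGR₁) (@χWR @hGR @hGR₀ @hGR₁ @μ) V c) (νR @hGR₁ V c))))
          (continuous_centerCharInf V _ hcV) +
        centralTypeOf V ⟨dW c.D 0, dW_real c.D 0, dW_ne c.D 0⟩ (hGR₀ V c) :=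
  muLiu_mk_eq_add_of_CC V hρ ⟨dW c.D 0, dW_real c.D 0, dW_ne c.D 0⟩ (SignRecipe.GoodCtx.self_mem_lineType hc.2 0) (hGR₀ V c) _ hcV
    (fun t => lineCharV_zero_center_mul_lineC_ROGT'C @hGR @hGR₀ @hGR₁ @μ V c hc t)

/-- **slot 1 at the R2 pin**: `muLiu ι₁ ρ ⟦a₁⟧ = charArchType (s₁ ∘ centre_∞) + centralTypeOf V a₁ (hGR₁ V c)` (`s₁ = νR V c`, #CA72
`lineCharV_one_etaT₁`). [folklore] -/
theorem muLiu_mk_eq_add_ROGT'C_one (hρ : ∀ q, GramClass.mk (ρ q) = q) (hc : GOG V c)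
    (hcV : Continuous fun v => ((lineCharV_one V c.D (hGR V c) (hGR₀ V c) (hGR₁ V c)
      (etaT₁ V c.D (EtaChi.η (@χVR @hGR @hGR₀ @hGR₁) (@χWR @hGR @hGR₀ @hGR₁ @μ) V c) (νR @hGR₁ V c)) v : ℂˣ) : ℂ)) :
    muLiu ι₁ ρ (GramClass.mk ⟨dW c.D 1, dW_real c.D 1, dW_ne c.D 1⟩) =
      Literature.NumberTheory.Automorphic.charArchType (L : Type)
          (centerCharInf V (lineCharV_one V c.D (hGR V c) (hGR₀ V c) (hGR₁ V c)
            (etaT₁ V c.D (EtaChi.η (@χVR @hGR @hGR₀ @hGR₁) (@χWR @hGR @hGR₀ @hGR₁ @μ) V c) (νR @hGR₁ V c))))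
          (continuous_centerCharInf V _ hcV) +
        centralTypeOf V ⟨dW c.D 1, dW_real c.D 1, dW_ne c.D 1⟩ (hGR₁ V c) :=
  muLiu_mk_eq_add_of_CC V hρ ⟨dW c.D 1, dW_real c.D 1, dW_ne c.D 1⟩ (SignRecipe.GoodCtx.self_mem_lineType hc.2 1) (hGR₁ V c) _ hcV
    (fun t => lineCharV_one_center_mul_lineC_ROGT'C @hGR @hGR₀ @hGR₁ @μ V c hc t)

/-- **slot 2 at the R2 pin** (conjugated plane, `a₂ = ⟨dW' c.D 0, …⟩ = ⟨c.D.a 2, …⟩`). [folklore] -/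
theorem muLiu_mk_eq_add_ROGT'C_two (hρ : ∀ q, GramClass.mk (ρ q) = q) (hc : GOG V c)
    (hcV : Continuous fun v => ((lineCharV_two V c.D (hGR V c) (hGR₂ V c) (hGR₃ V c)
      (etaT₂ V c.D (EtaChi.η (@χVR @hGR @hGR₀ @hGR₁) (@χWR @hGR @hGR₀ @hGR₁ @μ) V c) (ν'R @hGR₃ V c)) v : ℂˣ) : ℂ)) :
    muLiu ι₁ ρ (GramClass.mk ⟨dW' c.D 0, dW'_real c.D 0, dW'_ne c.D 0⟩) =
      Literature.NumberTheory.Automorphic.charArchType (L : Type)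
          (centerCharInf V (lineCharV_two V c.D (hGR V c) (hGR₂ V c) (hGR₃ V c)
            (etaT₂ V c.D (EtaChi.η (@χVR @hGR @hGR₀ @hGR₁) (@χWR @hGR @hGR₀ @hGR₁ @μ) V c) (ν'R @hGR₃ V c))))
          (continuous_centerCharInf V _ hcV) +
        centralTypeOf V ⟨dW' c.D 0, dW'_real c.D 0, dW'_ne c.D 0⟩ (hGR₂ V c) :=
  muLiu_mk_eq_add_of_CC V hρ ⟨dW' c.D 0, dW'_real c.D 0, dW'_ne c.D 0⟩ (SignRecipe.GoodCtx.self_mem_lineType hc.2 2) (hGR₂ V c) _ hcV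
    (fun t => lineCharV_two_center_mul_lineC_ROGT'C @hGR @hGR₀ @hGR₁ @hGR₂ @hGR₃ @μ V c hc t)

/-- **slot 3 at the R2 pin** (conjugated plane, `a₃ = ⟨dW' c.D 1, …⟩ = ⟨c.D.a 3, …⟩`). [folklore] -/
theorem muLiu_mk_eq_add_ROGT'C_three (hρ : ∀ q, GramClass.mk (ρ q) = q) (hc : GOG V c)
    (hcV : Continuous fun v => ((lineCharV_three V c.D (hGR V c) (hGR₂ V c) (hGR₃ V c)
      (etaT₃ V c.D (EtaChi.η (@χVR @hGR @hGR₀ @hGR₁) (@χWR @hGR @hGR₀ @hGR₁ @μ) V c) (ν'R @hGR₃ V c)) v : ℂˣ) : ℂ)) :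
    muLiu ι₁ ρ (GramClass.mk ⟨dW' c.D 1, dW'_real c.D 1, dW'_ne c.D 1⟩) =
      Literature.NumberTheory.Automorphic.charArchType (L : Type)
          (centerCharInf V (lineCharV_three V c.D (hGR V c) (hGR₂ V c) (hGR₃ V c)
            (etaT₃ V c.D (EtaChi.η (@χVR @hGR @hGR₀ @hGR₁) (@χWR @hGR @hGR₀ @hGR₁ @μ) V c) (ν'R @hGR₃ V c))))
          (continuous_centerCharInf V _ hcV) +
        centralTypeOf V ⟨dW' c.D 1, dW'_real c.D 1, dW'_ne c.D 1⟩ (hGR₃ V c) :=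
  muLiu_mk_eq_add_of_CC V hρ ⟨dW' c.D 1, dW'_real c.D 1, dW'_ne c.D 1⟩ (SignRecipe.GoodCtx.self_mem_lineType hc.2 3) (hGR₃ V c) _ hcV
    (fun t => lineCharV_three_center_mul_lineC_ROGT'C @hGR @hGR₀ @hGR₁ @hGR₂ @hGR₃ @μ V c hc t)

/-- **all four slots read `−𝟙_{w(ι₁)}` at the recipe of record** (the value binder-2's «ATqI» junction sees; `k : Fin 4` over E's `c.D.a k`). [folklore] -/
theorem muLiu_mk_slot_eq (hρ : ∀ q, GramClass.mk (ρ q) = q) (hc : GOG V c) (k : Fin 4) :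
    muLiu ι₁ ρ (GramClass.mk ⟨c.D.a k, c.D.a_real k, c.D.a_ne k⟩) = -placeIndicator ι₁ :=
  muLiu_mk_slot hρ hc.2 k

/-- the pointed section of binder-2 #103 is a section of `mk` (the `hρ` of every lemma above at `ρ := repAt a₀`). [folklore] -/
theorem mk_repAt (a₀ : RealScalar L) : ∀ q : GramClass L, GramClass.mk (repAt a₀ q) = q :=
  fun q => repAt_spec a₀ q

end HodgeCM.Model.LiuIndex

end
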